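import Literature.ModelTheory.UniversalTheories.HerbrandSaturation
import HarnessLib

/-!
# Herbrand's theorem for universal theories (semantic form)

Topic `Literature/ModelTheory/UniversalTheories` (companion of `HerbrandSaturation.lean`).

**Herbrand's theorem** (Herbrand 1930; in the form of Avigad 2002, Theorem 2.1): if `T` is a
universal theory and `T ⊢ ∃ ȳ φ(x̄, ȳ)` with `φ` quantifier-free (free variables `x̄`), then there
are finitely many tuples of terms `t̄₁(x̄), …, t̄ₖ(x̄)` in the free variables shown with
`T ⊢ φ(x̄, t̄₁(x̄)) ∨ ⋯ ∨ φ(x̄, t̄ₖ(x̄))`.  Provability is Mathlib's semantic consequence `⊨ᵇ`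
(equivalent by completeness, as Avigad remarks).  We give the model-theoretic proof printed by
Avigad (loc. cit., p. 3–4): if the conclusion fails, then by compactness `T` together with all the
sentences `¬ φ(c̄, t̄(c̄))` (`c̄` new constants naming the free variables) has a model; its
substructure generated by `c̄` is a model of `T` (as `T` is universal) in which `∃ ȳ φ(c̄, ȳ)` is
false.

* `instTerms φ t̄` — the instance `φ(x̄, t̄(x̄))` of the matrix at a tuple of terms, with
  `realize_instTerms`, `isQF_instTerms`;
* `herbrand` — the theorem, conclusion as `T ⊨ᵇ ⨆_{t̄ ∈ s} φ(x̄, t̄(x̄))` for a `Finset` `s`;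
* `herbrand_realize` — the same read in an arbitrary model of `T` (any universe): for every
  assignment of `x̄` one of the finitely many term tuples is a witness.

The hypothesis `Nonempty (L.Term α)` (a free variable or a constant exists) replaces Avigad's
standing assumption that every language has a constant; without it the statement is false
(`∅ ⊨ᵇ ∃ y (y = y)` over the empty language with no free variables, but there is no term).

This is the extraction step of the Herbrand-saturation method (Avigad 2002, §4; Krajíček 1995,
§7.6): once a `∀∃` consequence has been pushed down to a universal theory `T`
(`modelsBoundedFormula_exs_of_isHerbrandSaturated`, Avigad's Thm. 3.4), Herbrand's theorem and
definition by cases in `T` produce a witnessing term.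

## References

* J. Avigad, *Saturated models of universal theories*, Ann. Pure Appl. Logic 118 (2002),
  Theorem 2.1 and its model-theoretic proof (pp. 221–222 of the journal version; §2).
* J. Herbrand, *Recherches sur la théorie de la démonstration*, Thesis, Paris 1930.
* S. R. Buss, *An introduction to proof theory*, in: Handbook of Proof Theory, Elsevier 1998,
  §2.5 (Herbrand's theorem).
-/

universe u v w w'

open FirstOrder FirstOrder.Language FirstOrder.Language.BoundedFormula
open Set

namespace Literature.ModelTheory.UniversalTheories

variable {L : Language.{u, v}} {α : Type w} {m : ℕ}

/-! ## Term instances of a matrix -/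

/-- The instance `φ(x̄, t̄(x̄))` of a quantifier-free matrix `φ(x̄, ȳ)` (free variables `x̄ : α`,
bound variables `ȳ : Fin m`) at a tuple of terms `t̄` in the free variables (Avigad 2002,
statement of Theorem 2.1: `ψ(x̄, t̄ᵢ(x̄))`). [cite: Avigad2002, Theorem 2.1] -/
def instTerms (φ : L.BoundedFormula α m) (tt : Fin m → L.Term α) : L.Formula α :=
  (φ.toFormula).subst (Sum.elim Term.var tt)

/-- Semantics of `instTerms`: `φ(x̄, t̄(x̄))` holds at `v` iff `φ` holds at `v` with the bound
variables evaluated to the values of `t̄`. [folklore] -/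
theorem realize_instTerms {M : Type w'} [L.Structure M] (φ : L.BoundedFormula α m)
    (tt : Fin m → L.Term α) (v : α → M) :
    (instTerms φ tt).Realize v ↔ φ.Realize v (fun j => (tt j).realize v) := by
  unfold instTerms
  rw [Formula.Realize, realize_subst, ← Formula.Realize, realize_toFormula]
  rfl

/-- Term instances of quantifier-free matrices are quantifier-free. [folklore] -/
theorem isQF_instTerms {φ : L.BoundedFormula α m} (hφ : φ.IsQF) (tt : Fin m → L.Term α) :
    (instTerms φ tt).IsQF :=
  hφ.toFormula.subst _

/-! ## Herbrand's theorem -/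

/-- **Herbrand's theorem** (Avigad 2002, Theorem 2.1, semantic form).  Let `T` be a universal
theory and `φ(x̄, ȳ)` quantifier-free.  If `T ⊨ᵇ ∃ ȳ φ(x̄, ȳ)` (free variables read universally),
then there is a finite set `s` of tuples of terms `t̄(x̄)` with
`T ⊨ᵇ ⋁_{t̄ ∈ s} φ(x̄, t̄(x̄))`.  Proof: otherwise, by compactness, `T` plus all
`¬ φ(c̄, t̄(c̄))` has a model, whose substructure generated by the constants `c̄` is a model of
`T` falsifying `∃ ȳ φ(c̄, ȳ)`. [cite: Avigad2002, Theorem 2.1] -/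
theorem herbrand (T : L.Theory) [T.IsUniversal] [hne : Nonempty (L.Term α)]
    (φ : L.BoundedFormula α m) (hφ : φ.IsQF) (h : T ⊨ᵇ φ.exs) :
    ∃ s : Finset (Fin m → L.Term α),
      T ⊨ᵇ BoundedFormula.iSup (fun tt : ↥s => instTerms φ tt.1) := by
  classical
  by_contra hcon
  push Not at hcon
  -- all negated term instances of `φ`, as formulas about the (future) constants `α`
  let SI : Set (L.Formula α) := range fun tt : Fin m → L.Term α => ∼(instTerms φ tt)
  have hsat : ((L.lhomWithConstants α).onTheory T ∪ Formula.equivSentence '' SI).IsSatisfiable := by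
    rw [Theory.isSatisfiable_iff_isFinitelySatisfiable]
    intro T0 hT0
    -- the finitely many term tuples mentioned in `T0`
    let ch : L[[α]].Sentence → (Fin m → L.Term α) := fun σ =>
      if hσ : ∃ tt, σ = Formula.equivSentence (∼(instTerms φ tt)) then hσ.choose
      else fun _ => Classical.choice hne
    have hs := hcon (T0.image ch)
    simp only [Theory.ModelsBoundedFormula, not_forall] at hs
    obtain ⟨M, v, xs, hM⟩ := hs
    obtain rfl : xs = default := Subsingleton.elim _ _
    rw [realize_iSup] at hM
    push Not at hM
    letI : (constantsOn α).Structure M := constantsOn.structure v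
    have hTM : (M : Type _) ⊨ (L.lhomWithConstants α).onTheory T :=
      (LHom.onTheory_model _ T).2 M.is_model
    have hT0M : (M : Type _) ⊨ (T0 : L[[α]].Theory) := by
      refine ⟨fun σ hσ => ?_⟩
      rcases hT0 hσ with hσ' | ⟨ψ', hψ', rfl⟩
      · exact hTM.realize_of_mem σ hσ'
      rw [Formula.realize_equivSentence]
      change ψ'.Realize v
      obtain ⟨tt, rfl⟩ := hψ'
      have hex : ∃ tt', Formula.equivSentence (∼(instTerms φ tt)) =
          Formula.equivSentence (∼(instTerms φ tt')) := ⟨tt, rfl⟩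
      have hch : ch (Formula.equivSentence (∼(instTerms φ tt))) = hex.choose := dif_pos hex
      have heq : ∼(instTerms φ tt) = ∼(instTerms φ hex.choose) :=
        Formula.equivSentence.injective hex.choose_spec
      have hmem : hex.choose ∈ T0.image ch := by
        rw [← hch]
        exact Finset.mem_image_of_mem ch hσ
      change Formula.Realize (∼(instTerms φ tt)) v
      rw [heq, Formula.realize_not]
      exact hM ⟨hex.choose, hmem⟩
    exact Theory.Model.isSatisfiable M
  obtain ⟨N, _, _, v, hNT, hv⟩ :=
    (isSatisfiable_union_image_equivSentence_iff T SI).1 hsat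
  -- the substructure of `N` generated by the constants
  haveI : N ⊨ T := hNT
  let K : L.Substructure N := Substructure.closure L (range v)
  let v' : α → K := fun a => ⟨v a, Substructure.subset_closure (mem_range_self a)⟩
  haveI : Nonempty K := ⟨(Classical.choice hne).realize v'⟩
  have hK : (φ.exs).Realize v' := h.realize_formula K
  obtain ⟨ys, hys⟩ := realize_exs.1 hK
  choose tt htt using fun j => exists_term_realize_eq_of_mem_closure v (ys j).2
  have h1 : φ.Realize ((K.subtype : K → N) ∘ v') ((K.subtype : K → N) ∘ ys) :=
    (hφ.realize_embedding K.subtype).2 hys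
  have e1 : (K.subtype : K → N) ∘ v' = v := rfl
  have e2 : (K.subtype : K → N) ∘ ys = fun j => (tt j).realize v :=
    funext fun j => (htt j).symm
  rw [e1, e2, ← realize_instTerms] at h1
  exact (hv _ ⟨tt, rfl⟩) h1

/-- **Herbrand's theorem, read in a model.**  Under the hypotheses of `herbrand`, there is a finite
set `s` of term tuples such that in every model `M` of `T` (any universe) and for every assignment
of the free variables, one of the tuples `t̄ ∈ s` witnesses `∃ ȳ φ(x̄, ȳ)`.
[cite: Avigad2002, Theorem 2.1] -/
theorem herbrand_realize (T : L.Theory) [T.IsUniversal] [Nonempty (L.Term α)]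
    (φ : L.BoundedFormula α m) (hφ : φ.IsQF) (h : T ⊨ᵇ φ.exs) :
    ∃ s : Finset (Fin m → L.Term α), ∀ (M : Type w') [L.Structure M] [M ⊨ T] [Nonempty M]
      (v : α → M), ∃ tt ∈ s, φ.Realize v (fun j => (tt j).realize v) := by
  obtain ⟨s, hs⟩ := herbrand T φ hφ h
  refine ⟨s, fun M _ _ _ v => ?_⟩
  have h1 : BoundedFormula.Realize (BoundedFormula.iSup fun tt : ↥s => instTerms φ tt.1) v
      default := hs.realize_formula M (v := v)
  rw [realize_iSup] at h1
  obtain ⟨⟨tt, htt⟩, h2⟩ := h1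
  exact ⟨tt, htt, (realize_instTerms φ tt v).1 h2⟩

end Literature.ModelTheory.UniversalTheories
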